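import Summits.QuantumFields.YangMills.Theorems.LuscherReductionTwistedTraceScalingBTKineticSquares
import Literature.MathematicalPhysics.QuantumFieldTheory.Balaban1983to89.T4HaarSU2ExpChart
import HarnessLib

/-!
# Small quaternion balls have polynomial Haar mass: `Haar{‖q(g) − 1‖ ≤ ρ} ≥ ρ³/10` (`0 < ρ ≤ 1`), the gauge core `G_c(ρ) = {∀x ‖q(g_x) − 1‖ ≤ ρ}` has
# `Haar^Λ(G_c) = Haar(ball)^{|Λ|}`, and its colour mean lies in `fpBall ε` once `2ρ < ε`
# (lane A of S-BASE, crux `TwistedTraceScaling` stmt-QuantumFields-20203, C4-CORE, the (B-T) pen; design note `pub/ym-fleet/ym-luscher-20007-p1/COARSE-DESIGN.md` §25.9 (floor))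

Via the exponential chart of `SU(2)` (`Literature/…/T4HaarSU2ExpChart`: `Haar(expPoint '' A) = (2π²)⁻¹∫_A sinc²‖x‖ d³x`):
* `norm_exp_imQuat_sub_one_le` — `‖exp(ιx) − 1‖ ≤ ‖x‖` (`1 − t²/2 ≤ cos t`), so `expPoint '' ball(0,ρ) ⊆ quatBall ρ`;
* `expWeight_ge` — `w_exp ≥ (2π²)⁻¹(5/6)²` on `ball(0,1)` (`t − t³/6 < sin t`);
* ★ `haarReal_quatBall_ge` — `Haar.real{g : ‖q(g) − 1‖ ≤ ρ} ≥ ρ³/10` for `0 < ρ ≤ 1`;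
* `gaugeCore`, `measurableSet_gaugeCore`, ★ `gaugeMeasure_real_gaugeCore` (`= Haar.real(quatBall ρ)^{|Λ|}`), `gaugeMeasure_real_gaugeCore_ge` (`≥ (ρ³/10)^{|Λ|}`);
* `jump_le_of_mem_gaugeCore` (`‖q(g_y) − q(g_x)‖ ≤ 2ρ`), ★ `colourMean_mem_fpBall_of_mem_gaugeCore` (`ρ < 1`, `2ρ < ε`).
HONEST FRAMING: measure bookkeeping for a stub of a child of the CONDITIONAL reduction route R2b1; C4-CORE OPEN; not infinite volume, not a gap, not Clay.
-/

set_option autoImplicit false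

noncomputable section

open MeasureTheory Filter Topology Real Metric Set
open scoped BigOperators Matrix Quaternion ENNReal
open Literature.MathematicalPhysics.QuantumFieldTheory
open Literature.MathematicalPhysics.QuantumLattice
open Literature.MathematicalPhysics.QuantumFieldTheory.Balaban1983to89.T4HaarSU2ExpChart

namespace Summit.QuantumFields.YangMills.Theorems.FemtoTransferGap.TwoLattice.ConstTube

open Summit.QuantumFields.YangMills.Theorems.FemtoTransferGap
open Summit.QuantumFields.YangMills.Theorems.FemtoTransferGap.TwoLattice
open Summit.QuantumFields.YangMills.Theorems.FemtoTransferGap.TwoLattice.Avg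

variable (L : ℕ) [NeZero L]

/-- **The quaternion ball** `{g : ‖q(g) − 1‖ ≤ ρ}` in `SU(2)`. [folklore] -/
def quatBall (ρ : ℝ) : Set SU2 := {g | ‖su2Quat g - 1‖ ≤ ρ}

/-- **The gauge core** `G_c(ρ) = {g : ∀ x, ‖q(g_x) − 1‖ ≤ ρ}`. [folklore] -/
def gaugeCore (ρ : ℝ) : Set (Site 3 L → SU2) := {g | ∀ x, ‖su2Quat (g x) - 1‖ ≤ ρ}

variable {L}

/-! ## §1 The exponential chart lands in the quaternion ball -/

omit [NeZero L] in
/-- `‖exp(ιx) − 1‖ ≤ ‖x‖`. [folklore] -/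
theorem norm_exp_imQuat_sub_one_le (x : EuclideanSpace ℝ (Fin 3)) : ‖NormedSpace.exp (imQuat x) - 1‖ ≤ ‖x‖ := by
  have hn := norm_exp_imQuat x
  have hre := exp_imQuat_re x
  have hns : Quaternion.normSq (NormedSpace.exp (imQuat x)) = 1 := by rw [Quaternion.normSq_eq_norm_mul_self, hn, mul_one]
  have h1 : ‖NormedSpace.exp (imQuat x) - 1‖ ^ 2 = 2 - 2 * Real.cos ‖x‖ := by
    rw [sq, ← Quaternion.normSq_eq_norm_mul_self, Quaternion.normSq_def']
    rw [Quaternion.normSq_def'] at hns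
    simp only [Quaternion.re_sub, Quaternion.imI_sub, Quaternion.imJ_sub, Quaternion.imK_sub, Quaternion.re_one, Quaternion.imI_one, Quaternion.imJ_one,
      Quaternion.imK_one, sub_zero]
    rw [← hre]; nlinarith [hns]
  have h2 := Real.one_sub_sq_div_two_le_cos (x := ‖x‖)
  have h3 : ‖NormedSpace.exp (imQuat x) - 1‖ ^ 2 ≤ ‖x‖ ^ 2 := by rw [h1]; linarith
  exact (pow_le_pow_iff_left₀ (norm_nonneg _) (norm_nonneg _) two_ne_zero).mp h3

omit [NeZero L] in
/-- `expPoint '' ball(0,ρ) ⊆ quatBall ρ`. [folklore] -/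
theorem image_expPoint_ball_subset_quatBall (ρ : ℝ) : expPoint '' ball (0 : EuclideanSpace ℝ (Fin 3)) ρ ⊆ quatBall ρ := by
  rintro _ ⟨x, hx, rfl⟩
  rw [quatBall, mem_setOf_eq, su2Quat_expPoint]
  rw [mem_ball_zero_iff] at hx
  exact (norm_exp_imQuat_sub_one_le x).trans hx.le

/-! ## §2 The exponential-chart density is bounded below near the origin -/

omit [NeZero L] in
/-- `sinc t ≥ 5/6` for `|t| ≤ 1`. [folklore] -/
theorem sinc_ge_of_abs_le_one {t : ℝ} (ht : |t| ≤ 1) : 5 / 6 ≤ Real.sinc t := by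
  wlog h0 : 0 ≤ t generalizing t with H
  · have := H (t := -t) (by rwa [abs_neg]) (by linarith)
    rwa [Real.sinc_neg] at this
  rcases h0.eq_or_lt with h | hpos
  · rw [← h, Real.sinc_zero]; norm_num
  · rw [Real.sinc_of_ne_zero hpos.ne', le_div_iff₀ hpos]
    have h1 := Real.sin_gt_sub_cube hpos
    have ht1 : t ≤ 1 := (abs_le.mp ht).2
    nlinarith [pow_le_one₀ hpos.le ht1 (n := 2), pow_pos hpos 3, mul_le_mul_of_nonneg_left ht1 (sq_nonneg t)]

omit [NeZero L] in
/-- `w_exp(x) ≥ (2π²)⁻¹·(25/36)` on `ball(0,1)`. [folklore] -/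
theorem expWeight_ge {x : EuclideanSpace ℝ (Fin 3)} (hx : x ∈ ball (0 : EuclideanSpace ℝ (Fin 3)) 1) : (2 * π ^ 2)⁻¹ * (25 / 36) ≤ expWeight x := by
  unfold expWeight
  rw [mem_ball_zero_iff] at hx
  have hs := sinc_ge_of_abs_le_one (t := ‖x‖) (by rw [abs_of_nonneg (norm_nonneg _)]; exact hx.le)
  refine mul_le_mul_of_nonneg_left ?_ (by positivity)
  nlinarith

/-! ## §3 ★ Haar mass of small quaternion balls -/

omit [NeZero L] in
/-- The quaternion ball is closed, hence measurable. [folklore] -/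
theorem measurableSet_quatBall (ρ : ℝ) : MeasurableSet (quatBall ρ) :=
  (isClosed_le ((Literature.MathematicalPhysics.QuantumFieldTheory.Balaban1983to89.T4HaarSU2Translate.continuous_su2Quat.sub
    continuous_const).norm) continuous_const).measurableSet

omit [NeZero L] in
/-- ★ `Haar.real{‖q(g) − 1‖ ≤ ρ} ≥ ρ³/10` for `0 < ρ ≤ 1`. [cite: BrockerTomDieck1985, I (5.4)] -/
theorem haarReal_quatBall_ge {ρ : ℝ} (hρ : 0 < ρ) (hρ1 : ρ ≤ 1) : ρ ^ 3 / 10 ≤ (haarProbability SU2).real (quatBall ρ) := by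
  have hsub : ball (0 : EuclideanSpace ℝ (Fin 3)) ρ ⊆ ball (0 : EuclideanSpace ℝ (Fin 3)) π :=
    ball_subset_ball (hρ1.trans (by linarith [Real.pi_gt_three]))
  have himg := haarProbability_image (A := ball (0 : EuclideanSpace ℝ (Fin 3)) ρ) measurableSet_ball hsub
  have hmono : haarProbability SU2 (expPoint '' ball (0 : EuclideanSpace ℝ (Fin 3)) ρ) ≤ haarProbability SU2 (quatBall ρ) :=
    measure_mono (image_expPoint_ball_subset_quatBall ρ)
  -- the chart integral from below
  have hvol : (volume (ball (0 : EuclideanSpace ℝ (Fin 3)) ρ)).toReal = ρ ^ 3 * (π * 4 / 3) := by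
    rw [EuclideanSpace.volume_ball_fin_three, ENNReal.toReal_mul, ← ENNReal.ofReal_pow hρ.le, ENNReal.toReal_ofReal (by positivity),
      ENNReal.toReal_ofReal (by positivity)]
  have hfin : volume (ball (0 : EuclideanSpace ℝ (Fin 3)) ρ) < ∞ := measure_ball_lt_top
  have hint : IntegrableOn expWeight (ball (0 : EuclideanSpace ℝ (Fin 3)) ρ) volume :=
    Measure.integrableOn_of_bounded hfin.ne measurable_expWeight.aestronglyMeasurable (ae_of_all _ fun x => by
      rw [Real.norm_eq_abs, abs_of_nonneg (expWeight_nonneg x)]; exact expWeight_le x)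
  have hlow : (2 * π ^ 2)⁻¹ * (25 / 36) * (ρ ^ 3 * (π * 4 / 3)) ≤ ∫ x in ball (0 : EuclideanSpace ℝ (Fin 3)) ρ, expWeight x := by
    have h := setIntegral_mono_on (integrableOn_const (C := (2 * π ^ 2)⁻¹ * (25 / 36)) hfin.ne) hint measurableSet_ball
      (fun x hx => expWeight_ge (ball_subset_ball hρ1 hx))
    rw [setIntegral_const, smul_eq_mul, Measure.real, hvol] at h
    linarith
  have hπ : ρ ^ 3 / 10 ≤ (2 * π ^ 2)⁻¹ * (25 / 36) * (ρ ^ 3 * (π * 4 / 3)) := by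
    have hπ3 := Real.pi_gt_three
    have hπ4 := Real.pi_lt_d2
    rw [div_le_iff₀ (by norm_num : (0 : ℝ) < 10)]
    field_simp
    nlinarith [pow_pos hρ 3, mul_pos (pow_pos hρ 3) (show (0 : ℝ) < π by linarith)]
  rw [measureReal_def]
  have hne : haarProbability SU2 (quatBall ρ) ≠ ∞ := measure_ne_top _ _
  rw [himg] at hmono
  have := (ENNReal.ofReal_le_iff_le_toReal hne).mp hmono
  linarith

/-! ## §4 The gauge core -/

/-- The gauge core is measurable. [folklore] -/
theorem measurableSet_gaugeCore (ρ : ℝ) : MeasurableSet (gaugeCore L ρ) := by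
  have h : gaugeCore L ρ = Set.pi Set.univ fun _ : Site 3 L => quatBall ρ := by
    ext g; simp [gaugeCore, quatBall]
  rw [h]
  exact MeasurableSet.univ_pi fun _ => measurableSet_quatBall ρ

/-- ★ `Haar^Λ(G_c(ρ)) = Haar(quatBall ρ)^{|Λ|}`. [folklore] -/
theorem gaugeMeasure_real_gaugeCore (ρ : ℝ) : (gaugeMeasure L).real (gaugeCore L ρ) = (haarProbability SU2).real (quatBall ρ) ^ Fintype.card (Site 3 L) := by
  have h : gaugeCore L ρ = Set.pi Set.univ fun _ : Site 3 L => quatBall ρ := by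
    ext g; simp [gaugeCore, quatBall]
  rw [measureReal_def, h, gaugeMeasure, Measure.pi_pi, Finset.prod_const, Finset.card_univ, ENNReal.toReal_pow, measureReal_def]

/-- `Haar^Λ(G_c(ρ)) ≥ (ρ³/10)^{|Λ|}` for `0 < ρ ≤ 1`. [folklore] -/
theorem gaugeMeasure_real_gaugeCore_ge {ρ : ℝ} (hρ : 0 < ρ) (hρ1 : ρ ≤ 1) : (ρ ^ 3 / 10) ^ Fintype.card (Site 3 L) ≤ (gaugeMeasure L).real (gaugeCore L ρ) := by
  rw [gaugeMeasure_real_gaugeCore]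
  exact pow_le_pow_left₀ (by positivity) (haarReal_quatBall_ge hρ hρ1) _

omit [NeZero L] in
/-- Jumps inside the core are `≤ 2ρ`. [folklore] -/
theorem jump_le_of_mem_gaugeCore {ρ : ℝ} {g : Site 3 L → SU2} (hg : g ∈ gaugeCore L ρ) (x y : Site 3 L) : ‖su2Quat (g y) - su2Quat (g x)‖ ≤ 2 * ρ := by
  have h := norm_sub_le_norm_sub_add_norm_sub (su2Quat (g y)) 1 (su2Quat (g x))
  rw [norm_sub_rev (1 : ℍ)] at h
  linarith [hg x, hg y]

/-- ★ **The core lies in the Faddeev–Popov slab**: `ρ < 1`, `2ρ < ε` ⇒ `colourMean g ∈ fpBall ε` for `g ∈ G_c(ρ)`. [folklore] -/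
theorem colourMean_mem_fpBall_of_mem_gaugeCore {ρ ε : ℝ} (hρ1 : ρ < 1) (hε : 2 * ρ < ε) {g : Site 3 L → SU2} (hg : g ∈ gaugeCore L ρ) :
    colourMean L g ∈ fpBall ε := by
  have hN : (0 : ℝ) < Fintype.card (Site 3 L) := by exact_mod_cast Fintype.card_pos
  have hρ0 : 0 ≤ ρ := (norm_nonneg _).trans (hg 0)
  -- `‖S − N·1‖ ≤ Nρ`
  have hE : ‖colourQuatSum L g - (Fintype.card (Site 3 L) : ℝ) • (1 : ℍ)‖ ≤ Fintype.card (Site 3 L) * ρ := by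
    unfold colourQuatSum
    have e : ∑ x : Site 3 L, su2Quat (g x) - (Fintype.card (Site 3 L) : ℝ) • (1 : ℍ) = ∑ x : Site 3 L, (su2Quat (g x) - 1) := by
      rw [Finset.sum_sub_distrib, Finset.sum_const, Finset.card_univ, ← Nat.cast_smul_eq_nsmul ℝ]
    rw [e]
    refine (norm_sum_le _ _).trans ((Finset.sum_le_sum fun x _ => hg x).trans ?_)
    rw [Finset.sum_const, Finset.card_univ, nsmul_eq_mul]
  have hn1 : ‖(Fintype.card (Site 3 L) : ℝ) • (1 : ℍ)‖ = Fintype.card (Site 3 L) := by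
    rw [norm_smul, norm_one, mul_one, Real.norm_eq_abs, abs_of_nonneg hN.le]
  have hSN : |‖colourQuatSum L g‖ - Fintype.card (Site 3 L)| ≤ Fintype.card (Site 3 L) * ρ := by
    have h2 := abs_norm_sub_norm_le (colourQuatSum L g) ((Fintype.card (Site 3 L) : ℝ) • (1 : ℍ))
    rw [hn1] at h2; exact h2.trans hE
  have hS0 : colourQuatSum L g ≠ 0 := by
    intro h0; rw [h0, norm_zero, zero_sub, abs_neg, abs_of_nonneg hN.le] at hSN; nlinarith
  have hn : 0 < ‖colourQuatSum L g‖ := norm_pos_iff.mpr hS0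
  have hm : colourMean L g = quatToSU2 (colourQuatSum L g) := by unfold colourMean; rw [if_neg hS0]
  show colourMean L g ∈ {c | ‖su2Quat c - 1‖ < ε}
  rw [mem_setOf_eq, hm, Literature.MathematicalPhysics.QuantumFieldTheory.Balaban1983to89.T4HaarSU2Translate.su2Quat_quatToSU2 hS0]
  -- `‖S/‖S‖ − S/N‖ ≤ ρ` and `‖S/N − 1‖ ≤ ρ`
  have h1 : ‖‖colourQuatSum L g‖⁻¹ • colourQuatSum L g - (Fintype.card (Site 3 L) : ℝ)⁻¹ • colourQuatSum L g‖ ≤ ρ := by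
    rw [← sub_smul, norm_smul, Real.norm_eq_abs]
    have e : |‖colourQuatSum L g‖⁻¹ - (Fintype.card (Site 3 L) : ℝ)⁻¹| * ‖colourQuatSum L g‖ =
        |‖colourQuatSum L g‖ - Fintype.card (Site 3 L)| / Fintype.card (Site 3 L) := by
      rw [show ‖colourQuatSum L g‖⁻¹ - (Fintype.card (Site 3 L) : ℝ)⁻¹ = (Fintype.card (Site 3 L) - ‖colourQuatSum L g‖) / (‖colourQuatSum L g‖ * Fintype.card (Site 3 L)) by
        field_simp, abs_div, abs_of_pos (mul_pos hn hN), abs_sub_comm]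
      field_simp
    rw [e, div_le_iff₀ hN]; linarith
  have h2 : ‖(Fintype.card (Site 3 L) : ℝ)⁻¹ • colourQuatSum L g - 1‖ ≤ ρ := by
    have e : (Fintype.card (Site 3 L) : ℝ)⁻¹ • colourQuatSum L g - 1 = (Fintype.card (Site 3 L) : ℝ)⁻¹ • (colourQuatSum L g - (Fintype.card (Site 3 L) : ℝ) • (1 : ℍ)) := by
      rw [smul_sub, smul_smul, inv_mul_cancel₀ hN.ne', one_smul]
    rw [e, norm_smul, Real.norm_eq_abs, abs_of_pos (inv_pos.mpr hN)]
    calc (Fintype.card (Site 3 L) : ℝ)⁻¹ * ‖colourQuatSum L g - (Fintype.card (Site 3 L) : ℝ) • (1 : ℍ)‖ ≤ (Fintype.card (Site 3 L) : ℝ)⁻¹ * (Fintype.card (Site 3 L) * ρ) :=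
          mul_le_mul_of_nonneg_left hE (inv_pos.mpr hN).le
      _ = ρ := by field_simp
  calc ‖‖colourQuatSum L g‖⁻¹ • colourQuatSum L g - 1‖
      ≤ ‖‖colourQuatSum L g‖⁻¹ • colourQuatSum L g - (Fintype.card (Site 3 L) : ℝ)⁻¹ • colourQuatSum L g‖ + ‖(Fintype.card (Site 3 L) : ℝ)⁻¹ • colourQuatSum L g - 1‖ :=
        norm_sub_le_norm_sub_add_norm_sub _ _ _
    _ ≤ ρ + ρ := add_le_add h1 h2
    _ < ε := by linarith

end Summit.QuantumFields.YangMills.Theorems.FemtoTransferGap.TwoLattice.ConstTube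

end
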